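import Summits.BirchSwinnertonDyer.BirchSwinnertonDyer.Theorems.Rank2Observatory2DescKillValid
import HarnessLib

/-!
# KERNEL-2DESC — the SIGNATURE kill certificate `sig3Check` at an odd prime with three `ℤ_q`-roots
# (rank-2 observatory, cert-1 gen 38; design `b2b-bsdr2-cert-1/…/census/sigkill/SIGKILL-SPEC.md` §3–§4)

HONEST FRAMING: per-curve certified theorems and census instruments; no claim on BSD in rank ≥ 2.
PARTITION: none — rank ≥ 2 data (N3); no r ≤ 1 cell claimed.

SPLIT NOTE (cert-3 gen 27, mechanical; gate lint «Theorems files are ≤ 400 lines»): this is PART 1 of 2 of cert-1 gen 38's staged text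
`generics/sig3/lean/Rank2Observatory2DescKillSig3.lean` (sha256 4ed9af8c3fb1177d…): original lines 1–372 with every declaration verbatim —
integer helpers, `core`, `index_lemma`, `root_rel` and the certificate components up to `genOK` — except EDIT-1 (gate `dedup.landed`): the
helper `exists_pow_mul_not_dvd` (≡ the landed `Literature.NumberTheory.EllipticCurves.Int.exists_eq_pow_mul_not_dvd`) is deleted and its call
sites take the witnesses from Mathlib's `FiniteMultiplicity.exists_eq_pow_mul_and_not_dvd` directly. The disc walk `walk`, the certificate
`sig3Check` and the soundness theorems `walk_sound` … `sig3Check_sound`, `killValidAt_of_sig3Check` described below are in PART 2,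
`Rank2Observatory2DescKillSig3` (original lines 374–721 verbatim).

The landed kill layer certifies that the quadric pair `killQ = (Q₁, Q₂)` of a 2-descent class `z` has no
integer zero primitive at a prime `q` (`TwoDescKill.KillValidAt q a b c z t₁ t₂`) by ENUMERATING residue
vectors (`killCheck`, ≈ `2q³` evaluations per level; `l2Check`, `O(p²)`): out of reach at the primes where the
census finds most odd kills (`q = 29 … 863`).  This file certifies the SAME statement WITHOUT enumeration when
the field cubic `g = X³ + aX² + bX + c` has three roots `ε₁, ε₂, ε₃` in `ℤ_q` (given to precision `q^N`):

* a zero `v = (r₀, r₁, r₂, n)` of `killQ` means `z·r² = w₀ − n²·T` in `ℤ[α]` (`T = t₁α + t₂α²`,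
  `w₀ = (z·r²)₀ ∈ ℤ`); evaluating at `α ↦ εᵢ` (a ring map `ℤ[α] → ℤ/q^N`, `ev_zsq`) gives three congruences
  `Zᵢ·Rᵢ² ≡ w₀ − n²·eᵢ (mod q^N)` with `Zᵢ = z(εᵢ) = q^{sᵢ}·uᵢ`, `eᵢ = T(εᵢ)`, `Rᵢ = r(εᵢ)` (`root_rel`);
* the CORE LEMMA `core`: `q^N ∣ q^s·u·X² − q^j·w` with `q ∤ u, w`, `j < N` forces `s + j` even and
  `EulerBit u = EulerBit w` (`x^((q−1)/2) mod q`; Fermat) — by induction on `j`, no valuations;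
* if `q ∤ n`: `y = w₀/n²` satisfies `Zᵢ·□ ≡ y − eᵢ` for all `i`, and the DISC WALK `walk` over the residue
  discs `c + q^j ℤ_q` of `y` refutes it: a root OUTSIDE the disc has the fixed signature of `c − eᵢ`
  (`outMis`), the discs of the level-`j` digits of the INSIDE roots are refuted recursively, and on a generic
  digit every inside root has `v(y − eᵢ) = j` (parity test) and two inside roots with the same digit see the
  same unit digit (EulerBit test) (`walk_sound`);
* if `q ∣ n`: by the Vandermonde index bound (`index_lemma`, `D = Σ v_q(εᵢ − εⱼ)`) some `Rᵢ₀` has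
  `v_q ≤ D` (else `q ∣ r₀, r₁, r₂`: not primitive), so `v_q(w₀ − n²eᵢ₀) ≤ sᵢ₀ + 2D < N` (`val_bound`); either
  `n²` carries more `q` than that — then all three signatures coincide (the point is `q`-adically near `∞`),
  which the certificate excludes (`notRat`) — or `w₀ = q^{2τ}·w₀'` with `n = q^τ n'` and the walk runs with the
  even offset `2τ ≤ S + 2D` (`caseB`; the guard `j + S + 2D < N` at every node covers it).

`sig3Check q a b c z t₁ t₂ N ε₁ ε₂ ε₃ : Bool` costs a few dozen big-integer operations mod `q^N` (Euler bits on
residues `< q` via `Nat.pow`); `sig3Check_sound` has the signature of `killCheck_sound`, and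
`killValidAt_of_sig3Check` drops into `killListCheckV` / `admKillsV_sound` exactly like `killValidAt_of_l2Check`.
Scope: odd or even `q` (at `q = 2` the Euler bit is vacuous and the certificate merely weaker); three simple
roots of `g` in `ℤ_q` given mod `q^N` (reduced representatives); the producer chooses `N`.
[cite: Cassels1991LecturesEllipticCurves, §15] [cite: CremonaAlgorithms1997, §3.6]
-/

-- single-conjunct summit: `Summit.BirchSwinnertonDyer.BirchSwinnertonDyer.…` repeats the name by design
set_option linter.dupNamespace false

namespace Summit.BirchSwinnertonDyer.BirchSwinnertonDyer.Rank2Observatory.TwoDescKill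

/-! ### Integer helpers of the checker -/

/-- `splitPow q fuel x = (s, u)` with `x = q^s · u`; `q ∤ u` as soon as `x ≠ 0` and `fuel ≥ v_q(x)` — the
checker tests `q ∤ u` itself, so soundness only needs the product formula `splitPow_spec`. [folklore] -/
def splitPow (q : ℕ) : ℕ → ℤ → ℕ × ℤ
  | 0, x => (0, x)
  | f + 1, x =>
      if x ≠ 0 ∧ x % (q : ℤ) = 0 then ((splitPow q f (x / (q : ℤ))).1 + 1, (splitPow q f (x / (q : ℤ))).2)
      else (0, x)

/-- `x = q^s · u` for `(s, u) = splitPow q fuel x`. [folklore] -/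
theorem splitPow_spec (q : ℕ) : ∀ (f : ℕ) (x : ℤ), x = (q : ℤ) ^ (splitPow q f x).1 * (splitPow q f x).2
  | 0, x => by simp [splitPow]
  | f + 1, x => by
      by_cases h : x ≠ 0 ∧ x % (q : ℤ) = 0
      · rw [splitPow, if_pos h]
        have ih := splitPow_spec q f (x / (q : ℤ))
        have hx : (q : ℤ) * (x / (q : ℤ)) = x := Int.mul_ediv_cancel' (Int.dvd_of_emod_eq_zero h.2)
        calc x = (q : ℤ) * (x / (q : ℤ)) := hx.symm
          _ = (q : ℤ) * ((q : ℤ) ^ (splitPow q f (x / (q : ℤ))).1 * (splitPow q f (x / (q : ℤ))).2) := by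
              rw [← ih]
          _ = _ := by rw [pow_succ]; ring
      · rw [splitPow, if_neg h]; simp

/-- Euler bit of an integer at `q`: `x^((q−1)/2) mod q = 1`, computed on the residue in `ℕ` (`Nat.pow`).
For `q ∤ x`, `q` odd, it is the quadratic character of `x` mod `q`. [folklore] -/
def eulerBit (q : ℕ) (x : ℤ) : Bool := ((x % (q : ℤ)).toNat ^ ((q - 1) / 2)) % q == 1

/-- The Euler bit only depends on the residue. [folklore] -/
theorem eulerBit_congr {q : ℕ} {x y : ℤ} (h : (q : ℤ) ∣ x - y) : eulerBit q x = eulerBit q y := by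
  have : x % (q : ℤ) = y % (q : ℤ) := (Int.modEq_iff_dvd.mpr h).symm
  simp only [eulerBit, this]

/-- **Euler's criterion, multiplicativity**: `q ∣ u·X² − w` with `q ∤ X` gives equal Euler bits. [folklore] -/
theorem eulerBit_mul_sq {q : ℕ} (hq : q.Prime) {u w X : ℤ} (hX : ¬ (q : ℤ) ∣ X)
    (h : (q : ℤ) ∣ u * X ^ 2 - w) : eulerBit q u = eulerBit q w := by
  have hpZ : Prime (q : ℤ) := Nat.prime_iff_prime_int.mp hq
  have hq0 : (0 : ℤ) < q := by exact_mod_cast hq.pos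
  set e : ℕ := (q - 1) / 2 with he
  -- `u^e ≡ w^e (mod q)`
  have hpow : u ^ e ≡ w ^ e [ZMOD (q : ℤ)] := by
    rcases hq.eq_two_or_odd' with h2 | hodd
    · subst h2
      have : e = 0 := by rw [he]
      rw [this, pow_zero, pow_zero]
    · have h2e : 2 * e = q - 1 := by rw [he]; exact Nat.two_mul_div_two_of_even (Nat.Odd.sub_odd hodd odd_one)
      have hw : w ≡ u * X ^ 2 [ZMOD (q : ℤ)] := Int.modEq_iff_dvd.mpr h
      have hcop : IsCoprime X (q : ℤ) := ((Prime.coprime_iff_not_dvd hpZ).mpr hX).symm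
      have hF : X ^ (q - 1) ≡ 1 [ZMOD (q : ℤ)] := Int.ModEq.pow_card_sub_one_eq_one hq hcop
      have h1 : (u * X ^ 2) ^ e = u ^ e * X ^ (q - 1) := by rw [← h2e, mul_pow, ← pow_mul]
      have h3 : u ^ e * X ^ (q - 1) ≡ u ^ e * 1 [ZMOD (q : ℤ)] := hF.mul_left _
      rw [mul_one] at h3
      have h4 : (u * X ^ 2) ^ e ≡ u ^ e [ZMOD (q : ℤ)] := by rw [h1]; exact h3
      exact ((hw.pow e).trans h4).symm
  have hres : (u % (q : ℤ)) ^ e % (q : ℤ) = (w % (q : ℤ)) ^ e % (q : ℤ) :=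
    ((Int.mod_modEq u (q : ℤ)).pow e).trans (hpow.trans ((Int.mod_modEq w (q : ℤ)).pow e).symm)
  have hu0 : ((u % (q : ℤ)).toNat : ℤ) = u % (q : ℤ) := Int.toNat_of_nonneg (Int.emod_nonneg _ hq0.ne')
  have hw0 : ((w % (q : ℤ)).toNat : ℤ) = w % (q : ℤ) := Int.toNat_of_nonneg (Int.emod_nonneg _ hq0.ne')
  rw [← hu0, ← hw0] at hres
  have key' : (u % (q : ℤ)).toNat ^ e % q = (w % (q : ℤ)).toNat ^ e % q := by exact_mod_cast hres
  simp only [eulerBit, ← he, key']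

/-- **Core lemma.** `q^N ∣ q^s·u·X² − q^j·w` with `q ∤ u`, `q ∤ w`, `j < N` forces `s + j` even and equal
Euler bits of `u` and `w`. Induction on `j` (peel one `q`, or `q ∣ X` and peel `q²`); no valuations. [folklore] -/
theorem core {q : ℕ} (hq : q.Prime) {u w : ℤ} (hu : ¬ (q : ℤ) ∣ u) (hw : ¬ (q : ℤ) ∣ w) (j : ℕ) :
    ∀ (s N : ℕ) (X : ℤ), j < N → (q : ℤ) ^ N ∣ (q : ℤ) ^ s * u * X ^ 2 - (q : ℤ) ^ j * w →
      (s + j) % 2 = 0 ∧ eulerBit q u = eulerBit q w := by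
  induction' j using Nat.strong_induction_on with j ih
  intro s N X hjN h
  have hpZ : Prime (q : ℤ) := Nat.prime_iff_prime_int.mp hq
  have hq0 : (q : ℤ) ≠ 0 := by exact_mod_cast hq.ne_zero
  have hqN : (q : ℤ) ∣ (q : ℤ) ^ N := dvd_pow_self _ (by omega)
  cases j with
  | zero =>
    cases s with
    | zero =>
      refine ⟨by simp, ?_⟩
      have h' : (q : ℤ) ∣ u * X ^ 2 - w := by simpa using hqN.trans h
      have hX : ¬ (q : ℤ) ∣ X := by
        intro hX
        apply hw
        have h2 : (q : ℤ) ∣ u * X ^ 2 := dvd_mul_of_dvd_right (dvd_pow hX two_ne_zero) u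
        simpa using dvd_sub h2 h'
      exact eulerBit_mul_sq hq hX h'
    | succ s =>
      exfalso
      apply hw
      have h' := hqN.trans h
      have h2 : (q : ℤ) ∣ (q : ℤ) ^ (s + 1) * u * X ^ 2 :=
        dvd_mul_of_dvd_left (dvd_mul_of_dvd_left (dvd_pow_self _ (Nat.succ_ne_zero s)) u) _
      simpa using dvd_sub h2 h'
  | succ j =>
    cases s with
    | succ s =>
      obtain ⟨N', rfl⟩ : ∃ N', N = N' + 1 := ⟨N - 1, by omega⟩
      have h' : (q : ℤ) ^ N' ∣ (q : ℤ) ^ s * u * X ^ 2 - (q : ℤ) ^ j * w := by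
        have hh : (q : ℤ) * (q : ℤ) ^ N' ∣ (q : ℤ) * ((q : ℤ) ^ s * u * X ^ 2 - (q : ℤ) ^ j * w) := by
          have e1 : (q : ℤ) * (q : ℤ) ^ N' = (q : ℤ) ^ (N' + 1) := by ring
          have e2 : (q : ℤ) * ((q : ℤ) ^ s * u * X ^ 2 - (q : ℤ) ^ j * w) =
              (q : ℤ) ^ (s + 1) * u * X ^ 2 - (q : ℤ) ^ (j + 1) * w := by ring
          rw [e1, e2]
          exact h
        exact (mul_dvd_mul_iff_left hq0).mp hh
      have := ih j (by omega) s N' X (by omega) h'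
      exact ⟨by omega, this.2⟩
    | zero =>
      -- `q ∣ X`
      have h1 : (q : ℤ) ∣ u * X ^ 2 := by
        have h' := hqN.trans h
        have h2 : (q : ℤ) ∣ (q : ℤ) ^ (j + 1) * w := dvd_mul_of_dvd_left (dvd_pow_self _ (Nat.succ_ne_zero j)) w
        simpa using dvd_add h' h2
      have hX : (q : ℤ) ∣ X := by
        rcases hpZ.dvd_or_dvd h1 with h3 | h3
        · exact absurd h3 hu
        · exact hpZ.dvd_of_dvd_pow h3
      obtain ⟨X₁, rfl⟩ := hX
      cases j with
      | zero =>
        exfalso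
        apply hw
        obtain ⟨N', rfl⟩ : ∃ N', N = N' + 2 := ⟨N - 2, by omega⟩
        have hA : (q : ℤ) * q ∣ (q : ℤ) ^ 0 * u * ((q : ℤ) * X₁) ^ 2 - (q : ℤ) ^ (0 + 1) * w :=
          (show (q : ℤ) * q ∣ (q : ℤ) ^ (N' + 2) from ⟨(q : ℤ) ^ N', by ring⟩).trans h
        have h4 : (q : ℤ) * q ∣ (q : ℤ) * w := by
          have e : (q : ℤ) * w = (q : ℤ) * q * (u * X₁ ^ 2) -
              ((q : ℤ) ^ 0 * u * ((q : ℤ) * X₁) ^ 2 - (q : ℤ) ^ (0 + 1) * w) := by ring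
          rw [e]
          exact dvd_sub (dvd_mul_right _ _) hA
        exact (mul_dvd_mul_iff_left hq0).mp h4
      | succ j =>
        obtain ⟨N', rfl⟩ : ∃ N', N = N' + 2 := ⟨N - 2, by omega⟩
        have h' : (q : ℤ) ^ N' ∣ (q : ℤ) ^ 0 * u * X₁ ^ 2 - (q : ℤ) ^ j * w := by
          have hh : ((q : ℤ) * q) * (q : ℤ) ^ N' ∣ ((q : ℤ) * q) * ((q : ℤ) ^ 0 * u * X₁ ^ 2 - (q : ℤ) ^ j * w) := by
            have e1 : ((q : ℤ) * q) * (q : ℤ) ^ N' = (q : ℤ) ^ (N' + 2) := by ring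
            have e2 : ((q : ℤ) * q) * ((q : ℤ) ^ 0 * u * X₁ ^ 2 - (q : ℤ) ^ j * w) =
                (q : ℤ) ^ 0 * u * ((q : ℤ) * X₁) ^ 2 - (q : ℤ) ^ (j + 1 + 1) * w := by ring
            rw [e1, e2]
            exact h
          exact (mul_dvd_mul_iff_left (mul_ne_zero hq0 hq0)).mp hh
        have := ih j (by omega) 0 N' X₁ (by omega) h'
        exact ⟨by omega, this.2⟩

/-- `q^(D+1) ∤ R ⇒ q^(2D+1) ∤ R²`. [folklore] -/
theorem not_dvd_sq_of {q : ℕ} (hq : q.Prime) {R : ℤ} {D : ℕ} (hR : ¬ (q : ℤ) ^ (D + 1) ∣ R) :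
    ¬ (q : ℤ) ^ (2 * D + 1) ∣ R ^ 2 := by
  intro h
  have hpZ : Prime (q : ℤ) := Nat.prime_iff_prime_int.mp hq
  have hq0 : (q : ℤ) ≠ 0 := by exact_mod_cast hq.ne_zero
  have hR0 : R ≠ 0 := fun h0 => hR (h0 ▸ dvd_zero _)
  obtain ⟨ρ, R', hRR, hR'⟩ : ∃ (k : ℕ) (x' : ℤ), R = (q : ℤ) ^ k * x' ∧ ¬ (q : ℤ) ∣ x' :=
    ⟨_, (Int.finiteMultiplicity_iff.mpr ⟨by simpa using hq.one_lt.ne', hR0⟩).exists_eq_pow_mul_and_not_dvd⟩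
  have hρ : ρ ≤ D := by
    by_contra hlt
    push Not at hlt
    exact hR (hRR ▸ dvd_mul_of_dvd_left (pow_dvd_pow _ (by omega)) R')
  rw [hRR, mul_pow, ← pow_mul] at h
  obtain ⟨i, hi⟩ : ∃ i, 2 * D + 1 = ρ * 2 + (i + 1) := ⟨2 * D - 2 * ρ, by omega⟩
  rw [hi, pow_add] at h
  have h2 := (mul_dvd_mul_iff_left (pow_ne_zero _ hq0)).mp h
  exact hR' (hpZ.dvd_of_dvd_pow ((dvd_pow_self (q : ℤ) (Nat.succ_ne_zero i)).trans h2))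

/-- **Valuation bound at the good root**: `q^N ∣ q^s·u·R² − P` with `q ∤ u`, `q^(D+1) ∤ R`, `s + 2D < N`
gives `P = q^μ·P'`, `q ∤ P'`, `μ ≤ s + 2D`. [folklore] -/
theorem val_bound {q : ℕ} (hq : q.Prime) {s D N : ℕ} {u R P : ℤ} (hu : ¬ (q : ℤ) ∣ u)
    (hR : ¬ (q : ℤ) ^ (D + 1) ∣ R) (hN : s + 2 * D < N)
    (h : (q : ℤ) ^ N ∣ (q : ℤ) ^ s * u * R ^ 2 - P) :
    ∃ (μ : ℕ) (P' : ℤ), P = (q : ℤ) ^ μ * P' ∧ ¬ (q : ℤ) ∣ P' ∧ μ ≤ s + 2 * D := by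
  have hpZ : Prime (q : ℤ) := Nat.prime_iff_prime_int.mp hq
  have hq0 : (q : ℤ) ≠ 0 := by exact_mod_cast hq.ne_zero
  have hsq := not_dvd_sq_of hq hR
  have hkey : ¬ (q : ℤ) ^ (s + 2 * D + 1) ∣ (q : ℤ) ^ s * u * R ^ 2 := by
    intro hd
    rw [show s + 2 * D + 1 = s + (2 * D + 1) by omega, pow_add, mul_assoc] at hd
    have h2 := (mul_dvd_mul_iff_left (pow_ne_zero _ hq0)).mp hd
    have hcop : IsCoprime ((q : ℤ) ^ (2 * D + 1)) u := ((Prime.coprime_iff_not_dvd hpZ).mpr hu).pow_left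
    exact hsq (hcop.dvd_of_dvd_mul_left h2)
  have hP0 : P ≠ 0 := by
    rintro rfl
    apply hkey
    rw [sub_zero] at h
    exact (pow_dvd_pow _ (by omega)).trans h
  obtain ⟨μ, P', hP, hP'⟩ : ∃ (k : ℕ) (x' : ℤ), P = (q : ℤ) ^ k * x' ∧ ¬ (q : ℤ) ∣ x' :=
    ⟨_, (Int.finiteMultiplicity_iff.mpr ⟨by simpa using hq.one_lt.ne', hP0⟩).exists_eq_pow_mul_and_not_dvd⟩
  refine ⟨μ, P', hP, hP', ?_⟩
  by_contra hlt
  push Not at hlt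
  apply hkey
  have h1 : (q : ℤ) ^ (s + 2 * D + 1) ∣ P := hP ▸ dvd_mul_of_dvd_left (pow_dvd_pow _ (by omega)) P'
  have h2 : (q : ℤ) ^ (s + 2 * D + 1) ∣ (q : ℤ) ^ N := pow_dvd_pow _ (by omega)
  simpa using dvd_add (h2.trans h) h1

/-- **Index of the values at three approximate roots (Vandermonde, `adj V · V = det V · I`)**: if
`q^(D+1)` divides `r₀ + r₁εᵢ + r₂εᵢ²` for the three `εᵢ`, `D = Σ v_q(εᵢ − εⱼ)`, then `q ∣ r₀, r₁, r₂`. [folklore] -/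
theorem index_lemma {q : ℕ} (hq : q.Prime) {ε₁ ε₂ ε₃ r₀ r₁ r₂ : ℤ} {d₁₂ d₁₃ d₂₃ : ℕ} {f₁₂ f₁₃ f₂₃ : ℤ}
    (h₁₂ : ε₁ - ε₂ = (q : ℤ) ^ d₁₂ * f₁₂) (h₁₃ : ε₁ - ε₃ = (q : ℤ) ^ d₁₃ * f₁₃)
    (h₂₃ : ε₂ - ε₃ = (q : ℤ) ^ d₂₃ * f₂₃)
    (hf₁₂ : ¬ (q : ℤ) ∣ f₁₂) (hf₁₃ : ¬ (q : ℤ) ∣ f₁₃) (hf₂₃ : ¬ (q : ℤ) ∣ f₂₃)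
    (hR₁ : (q : ℤ) ^ (d₁₂ + d₁₃ + d₂₃ + 1) ∣ r₀ + r₁ * ε₁ + r₂ * ε₁ ^ 2)
    (hR₂ : (q : ℤ) ^ (d₁₂ + d₁₃ + d₂₃ + 1) ∣ r₀ + r₁ * ε₂ + r₂ * ε₂ ^ 2)
    (hR₃ : (q : ℤ) ^ (d₁₂ + d₁₃ + d₂₃ + 1) ∣ r₀ + r₁ * ε₃ + r₂ * ε₃ ^ 2) :
    (q : ℤ) ∣ r₀ ∧ (q : ℤ) ∣ r₁ ∧ (q : ℤ) ∣ r₂ := by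
  have hpZ : Prime (q : ℤ) := Nat.prime_iff_prime_int.mp hq
  have hq0 : (q : ℤ) ≠ 0 := by exact_mod_cast hq.ne_zero
  set D := d₁₂ + d₁₃ + d₂₃ with hD
  have hΔ : (ε₁ - ε₂) * (ε₁ - ε₃) * (ε₂ - ε₃) = (q : ℤ) ^ D * (f₁₂ * f₁₃ * f₂₃) := by
    rw [h₁₂, h₁₃, h₂₃, hD, pow_add, pow_add]; ring
  have hF : ¬ (q : ℤ) ∣ f₁₂ * f₁₃ * f₂₃ := by
    intro h
    rcases hpZ.dvd_or_dvd h with h | h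
    · rcases hpZ.dvd_or_dvd h with h | h
      · exact hf₁₂ h
      · exact hf₁₃ h
    · exact hf₂₃ h
  obtain ⟨k₁, hk₁⟩ := hR₁
  obtain ⟨k₂, hk₂⟩ := hR₂
  obtain ⟨k₃, hk₃⟩ := hR₃
  have aux : ∀ x k : ℤ, (ε₁ - ε₂) * (ε₁ - ε₃) * (ε₂ - ε₃) * x = (q : ℤ) ^ (D + 1) * k → (q : ℤ) ∣ x := by
    intro x k hx
    rw [hΔ, pow_succ] at hx
    have h1 : (q : ℤ) ^ D * (f₁₂ * f₁₃ * f₂₃ * x) = (q : ℤ) ^ D * ((q : ℤ) * k) := by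
      linear_combination hx
    have h2 := mul_left_cancel₀ (pow_ne_zero D hq0) h1
    rcases hpZ.dvd_or_dvd (⟨k, h2⟩ : (q : ℤ) ∣ f₁₂ * f₁₃ * f₂₃ * x) with h | h
    · exact absurd h hF
    · exact h
  refine ⟨aux r₀ (k₁ * (ε₂ * ε₃ * (ε₂ - ε₃)) - k₂ * (ε₁ * ε₃ * (ε₁ - ε₃)) + k₃ * (ε₁ * ε₂ * (ε₁ - ε₂))) ?_,
    aux r₁ (-(k₁ * (ε₂ ^ 2 - ε₃ ^ 2)) + k₂ * (ε₁ ^ 2 - ε₃ ^ 2) - k₃ * (ε₁ ^ 2 - ε₂ ^ 2)) ?_,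
    aux r₂ (k₁ * (ε₂ - ε₃) - k₂ * (ε₁ - ε₃) + k₃ * (ε₁ - ε₂)) ?_⟩
  · linear_combination (ε₂ * ε₃ * (ε₂ - ε₃)) * hk₁ - (ε₁ * ε₃ * (ε₁ - ε₃)) * hk₂ + (ε₁ * ε₂ * (ε₁ - ε₂)) * hk₃
  · linear_combination -(ε₂ ^ 2 - ε₃ ^ 2) * hk₁ + (ε₁ ^ 2 - ε₃ ^ 2) * hk₂ - (ε₁ ^ 2 - ε₂ ^ 2) * hk₃
  · linear_combination (ε₂ - ε₃) * hk₁ - (ε₁ - ε₃) * hk₂ + (ε₁ - ε₂) * hk₃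

/-! ### The kill relation at an approximate root -/

/-- **Evaluation at a root mod `q^N`.** If `g(ε) ≡ 0 (mod q^N)` and `killQ (r₀, r₁, r₂, n) = 0`, then with
`R = r₀ + r₁ε + r₂ε²`, `w₀ = (z·r²)₀`, `Z = z(ε) mod q^N`, `e = T(ε) mod q^N`:  `q^N ∣ Z·R² − (w₀ − n²·e)`
(the coordinates of `z·r² + n²T − w₀ = 0` pushed through `ℤ[α] → ℤ/q^N`, `α ↦ ε`; `ev_zsq`).
[cite: Cassels1991LecturesEllipticCurves, §15] -/
theorem root_rel {q N : ℕ} {a b c : ℤ} {z : ℤ × ℤ × ℤ} {t₁ t₂ ε : ℤ}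
    (hg : (ε ^ 3 + a * ε ^ 2 + b * ε + c) % ((q ^ N : ℕ) : ℤ) = 0) {r₀ r₁ r₂ n : ℤ}
    (h0 : killQ a b c z t₁ t₂ (r₀, r₁, r₂, n) = 0) :
    (q : ℤ) ^ N ∣ ((z.1 + z.2.1 * ε + z.2.2 * ε ^ 2) % ((q ^ N : ℕ) : ℤ)) * (r₀ + r₁ * ε + r₂ * ε ^ 2) ^ 2 -
      ((zsq a b c z (r₀, r₁, r₂)).1 - n ^ 2 * ((t₁ * ε + t₂ * ε ^ 2) % ((q ^ N : ℕ) : ℤ))) := by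
  set M : ℕ := q ^ N with hM
  have hMZ : ((M : ℕ) : ℤ) = (q : ℤ) ^ N := by rw [hM, Nat.cast_pow]
  -- the root in `ZMod M`
  have hα : (ε : ZMod M) ^ 3 + (a : ZMod M) * (ε : ZMod M) ^ 2 + (b : ZMod M) * (ε : ZMod M) + (c : ZMod M) = 0 := by
    have := (ZMod.intCast_zmod_eq_zero_iff_dvd _ M).mpr (Int.dvd_of_emod_eq_zero hg)
    push_cast at this
    exact this
  -- the two coordinates of `z·r² + n²T`
  have hQ1 : (zsq a b c z (r₀, r₁, r₂)).2.1 + t₁ * n ^ 2 = 0 := by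
    have := congrArg Prod.fst h0; simpa only [killQ, Prod.fst_zero] using this
  have hQ2 : (zsq a b c z (r₀, r₁, r₂)).2.2 + t₂ * n ^ 2 = 0 := by
    have := congrArg Prod.snd h0; simpa only [killQ, Prod.snd_zero] using this
  have hQ1' : ((zsq a b c z (r₀, r₁, r₂)).2.1 : ZMod M) + (t₁ : ZMod M) * (n : ZMod M) ^ 2 = 0 := by
    exact_mod_cast congrArg (Int.cast : ℤ → ZMod M) hQ1
  have hQ2' : ((zsq a b c z (r₀, r₁, r₂)).2.2 : ZMod M) + (t₂ : ZMod M) * (n : ZMod M) ^ 2 = 0 := by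
    exact_mod_cast congrArg (Int.cast : ℤ → ZMod M) hQ2
  -- `ev_ε (z·r²) = ev_ε z · (ev_ε r)²` in `ZMod M`
  have hmap := map_zsq (Int.castRingHom (ZMod M)) a b c z (r₀, r₁, r₂)
  simp only [eq_intCast] at hmap
  have hev := ev_zsq hα ((z.1 : ZMod M), (z.2.1 : ZMod M), (z.2.2 : ZMod M))
    ((r₀ : ZMod M), (r₁ : ZMod M), (r₂ : ZMod M))
  rw [← hmap] at hev
  simp only [ev] at hev
  -- the relation with exact `Z(ε)`, `T(ε)`
  have hd : ((M : ℕ) : ℤ) ∣ (z.1 + z.2.1 * ε + z.2.2 * ε ^ 2) * (r₀ + r₁ * ε + r₂ * ε ^ 2) ^ 2 -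
      ((zsq a b c z (r₀, r₁, r₂)).1 - n ^ 2 * (t₁ * ε + t₂ * ε ^ 2)) := by
    apply (ZMod.intCast_zmod_eq_zero_iff_dvd _ M).mp
    push_cast
    linear_combination (-1 : ZMod M) * hev + (ε : ZMod M) * hQ1' + (ε : ZMod M) ^ 2 * hQ2'
  -- reduce `Z`, `T` mod `M`
  rw [hMZ] at hd ⊢
  obtain ⟨k, hk⟩ := hd
  have e1 := Int.emod_add_ediv_mul (z.1 + z.2.1 * ε + z.2.2 * ε ^ 2) ((q : ℤ) ^ N)
  have e2 := Int.emod_add_ediv_mul (t₁ * ε + t₂ * ε ^ 2) ((q : ℤ) ^ N)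
  exact ⟨k - (z.1 + z.2.1 * ε + z.2.2 * ε ^ 2) / (q : ℤ) ^ N * (r₀ + r₁ * ε + r₂ * ε ^ 2) ^ 2 -
      n ^ 2 * ((t₁ * ε + t₂ * ε ^ 2) / (q : ℤ) ^ N), by
    linear_combination hk + (r₀ + r₁ * ε + r₂ * ε ^ 2) ^ 2 * e1 + n ^ 2 * e2⟩

/-! ### The certificate -/

/-- Per-root data `(e, s, u)`: `e = T(ε) mod q^N` and `Z(ε) mod q^N = q^s · u`. [folklore] -/
def rootData (q N : ℕ) (z : ℤ × ℤ × ℤ) (t₁ t₂ ε : ℤ) : ℤ × ℕ × ℤ :=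
  ((t₁ * ε + t₂ * ε ^ 2) % ((q ^ N : ℕ) : ℤ),
    splitPow q N ((z.1 + z.2.1 * ε + z.2.2 * ε ^ 2) % ((q ^ N : ℕ) : ℤ)))

/-- `q ∤ x`, decided. [folklore] -/
def unitOK (q : ℕ) (x : ℤ) : Bool := !decide (x % (q : ℤ) = 0)

/-- Root test: `g(ε) ≡ 0 (mod q^N)` and the unit part of `Z(ε)` is a unit. [folklore] -/
def rootOK (q N : ℕ) (a b c ε : ℤ) (ρ : ℤ × ℕ × ℤ) : Bool :=
  decide ((ε ^ 3 + a * ε ^ 2 + b * ε + c) % ((q ^ N : ℕ) : ℤ) = 0) && unitOK q ρ.2.2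

/-- Not RATIONAL-like: the three signatures `(s mod 2, EulerBit u)` are not all equal. [folklore] -/
def notRat (q : ℕ) (ρ₁ ρ₂ ρ₃ : ℤ × ℕ × ℤ) : Bool :=
  !(decide (ρ₁.2.1 % 2 = ρ₂.2.1 % 2) && decide (ρ₂.2.1 % 2 = ρ₃.2.1 % 2) &&
    decide (eulerBit q ρ₁.2.2 = eulerBit q ρ₂.2.2) && decide (eulerBit q ρ₂.2.2 = eulerBit q ρ₃.2.2))

/-- Is the root `ρ = (e, s, u)` INSIDE the disc `c + q^j ℤ_q`? [folklore] -/
def isIn (q : ℕ) (c : ℤ) (j : ℕ) (ρ : ℤ × ℕ × ℤ) : Bool := decide ((ρ.1 - c) % ((q ^ j : ℕ) : ℤ) = 0)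

/-- Level-`j` digit of `e − c` (for an inside root). [folklore] -/
def digitOf (q : ℕ) (c : ℤ) (j : ℕ) (ρ : ℤ × ℕ × ℤ) : ℤ := ((ρ.1 - c) / ((q ^ j : ℕ) : ℤ)) % (q : ℤ)

/-- Mismatch at a root OUTSIDE the disc `c + q^j ℤ_q`: `v_q(c − e) < j` and the root's signature
`(s mod 2, EulerBit u)` differs from that of `c − e`. [cite: CremonaAlgorithms1997, §3.6] -/
def outMis (q : ℕ) (c : ℤ) (j : ℕ) (ρ : ℤ × ℕ × ℤ) : Bool :=
  let δ := c - ρ.1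
  let sp := splitPow q j δ
  !decide (δ % ((q ^ j : ℕ) : ℤ) = 0) && !decide (sp.2 % (q : ℤ) = 0) &&
    (!decide (ρ.2.1 % 2 = sp.1 % 2) || !decide (eulerBit q ρ.2.2 = eulerBit q sp.2))

/-- Generic-digit test at a node: some inside root has the wrong valuation parity, or two inside roots with
the same digit have different Euler bits, or the inside digits exhaust `0 … q−1`. [folklore] -/
def genOK (q : ℕ) (c : ℤ) (j : ℕ) (ins : List (ℤ × ℕ × ℤ)) : Bool :=
  (ins.any fun ρ => !decide (ρ.2.1 % 2 = j % 2)) ||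
    (ins.any fun ρ => ins.any fun ρ' =>
      decide (digitOf q c j ρ = digitOf q c j ρ') && !decide (eulerBit q ρ.2.2 = eulerBit q ρ'.2.2)) ||
    ((List.range q).all fun d => ins.any fun ρ => decide (digitOf q c j ρ = (d : ℤ)))

end Summit.BirchSwinnertonDyer.BirchSwinnertonDyer.Rank2Observatory.TwoDescKill
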